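import Literature.Barriers.ABC.BakerMethodBoundsEpsShape

/-!
# Barrier (ABC), companion: threshold absorption for the `ε`-shape and the 1986 leaf from the 1991 leaf

`Literature/Barriers/ABC/BakerMethodBoundsEpsShapeThreshold.lean` — proofs-only sequel to
`BakerMethodBoundsEpsShape.lean` (no definition, no named fact).

Stewart–Yu, Math. Ann. 291 (1991), p. 226, state after their uniform theorem ("There exists an effectively
computable positive constant `c` such that for all positive integers `x, y`, and `z` with `(x, y, z) = 1`,
`z > 2`, and `x + y = z`, `log z < G^{2/3 + c/log log G}`"): "In particular, for each `ε > 0` there exists a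
number `c₄(ε)` which is effectively computable in terms of `ε` such that for all positive integers `x, y`,
and `z` with `(x, y, z) = 1` and `x + y = z`, `z < exp(c₄(ε)G^{2/3+ε})`" (GDZ scan of p. 226 read
2026-08-26) — with NO threshold on `z` (the threshold `z > 2` belongs to the uniform clause only);
Waldschmidt (2014), §2 reproduces it "for `c` sufficiently large in terms of `ε`", and the tree leaf
`Literature.Barriers.ABC.stewartYu1991_upperBound = EpsShapeBound (2/3)` is typed from Waldschmidt with an
explicit threshold `c ≥ c₀(ε)`.  Since `rad ≥ 1` and `log c ≤ log c₀` below the threshold, the two readings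
are equivalent up to the value of `κ(ε)` (`epsShapeBound_iff_thresholdFree`,
`stewartYu1991_iff_thresholdFree`); and the `ε`-form implies every `ε`-free shape `BakerShapeBound θ 0`
with `θ > θ₀` (`bakerShapeBound_of_epsShapeBound`), in particular the Stewart–Tijdeman 1986 leaf
(`stewartTijdeman1986_of_stewartYu1991`; Stewart–Yu 1991 p. 226: "In [7] Stewart and Tijdeman proved
that there exists an effectively computable constant `c₃` such that for all positive integers `x, y`, and
`z` satisfying (1), `log z < c₃G^{15}`", (1) = "`(x, y, z) = 1` and `x + y = z`", p. 225).
Effectivity of the constants is not part of any typed statement here (existential `κ`).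
-/

namespace Literature.Barriers.ABC

open Literature.NumberTheory.DiophantineGeometry

/-- **Threshold absorption.** For `θ₀ ≥ 0`, `EpsShapeBound θ₀` (threshold `c ≥ c₀(ε)`) is equivalent to the
threshold-free form `∀ ε > 0, ∃ κ, ∀ abc triples, log c ≤ κ · rad(abc)^{θ₀+ε}`; the new constant is
`max (max κ 0) (log (max c₀ 1))` (`rad ≥ 1`, `log c ≤ log c₀` for `c < c₀`).
[cite: StewartYu1991, Theorem (p. 226), "in particular" clause] [cite: Waldschmidt2014, §2] -/
theorem epsShapeBound_iff_thresholdFree {θ₀ : ℝ} (hθ : 0 ≤ θ₀) :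
    EpsShapeBound θ₀ ↔
      ∀ ε : ℝ, 0 < ε → ∃ κ : ℝ, ∀ a b c : ℕ, IsABCTriple a b c →
        Real.log c ≤ κ * (rad a b c : ℝ) ^ (θ₀ + ε : ℝ) := by
  constructor
  · intro h ε hε
    obtain ⟨κ, c₀, hκ⟩ := h ε hε
    refine ⟨max (max κ 0) (Real.log (max c₀ 1)), fun a b c ht => ?_⟩
    have hR : (1 : ℝ) ≤ (rad a b c : ℝ) := one_le_rad_real a b c
    have hRpow : (1 : ℝ) ≤ (rad a b c : ℝ) ^ (θ₀ + ε : ℝ) := Real.one_le_rpow hR (by linarith)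
    have hRpow0 : (0 : ℝ) ≤ (rad a b c : ℝ) ^ (θ₀ + ε : ℝ) := zero_le_one.trans hRpow
    have hK0 : (0 : ℝ) ≤ max (max κ 0) (Real.log (max c₀ 1)) :=
      le_trans (le_max_right κ 0) (le_max_left _ _)
    by_cases hc : c₀ ≤ (c : ℝ)
    · calc Real.log c ≤ κ * (rad a b c : ℝ) ^ (θ₀ + ε : ℝ) := hκ a b c ht hc
        _ ≤ max (max κ 0) (Real.log (max c₀ 1)) * (rad a b c : ℝ) ^ (θ₀ + ε : ℝ) :=
            mul_le_mul_of_nonneg_right (le_trans (le_max_left κ 0) (le_max_left _ _)) hRpow0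
    · rw [not_le] at hc
      obtain ⟨ha, hb, habc, -⟩ := ht
      have hcpos : (0 : ℝ) < c := by exact_mod_cast (show 0 < c by omega)
      have hlogc : Real.log c ≤ Real.log (max c₀ 1) :=
        Real.log_le_log hcpos (le_trans hc.le (le_max_left _ _))
      calc Real.log c ≤ max (max κ 0) (Real.log (max c₀ 1)) := hlogc.trans (le_max_right _ _)
        _ = max (max κ 0) (Real.log (max c₀ 1)) * 1 := (mul_one _).symm
        _ ≤ max (max κ 0) (Real.log (max c₀ 1)) * (rad a b c : ℝ) ^ (θ₀ + ε : ℝ) :=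
            mul_le_mul_of_nonneg_left hRpow hK0
  · intro h ε hε
    obtain ⟨κ, hκ⟩ := h ε hε
    exact ⟨κ, 0, fun a b c ht _ => hκ a b c ht⟩

/-- The threshold-free "in particular" clause of Stewart–Yu 1991 (p. 226: for each `ε > 0` a constant
`c₄(ε)` with `log z < c₄(ε) G^{2/3+ε}` for ALL coprime `x + y = z`) is equivalent to the tree leaf
`stewartYu1991_upperBound` (Waldschmidt's reproduction with "`c` sufficiently large in terms of `ε`").
[cite: StewartYu1991, Theorem (p. 226), "in particular" clause] [cite: Waldschmidt2014, §2] -/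
theorem stewartYu1991_iff_thresholdFree :
    stewartYu1991_upperBound ↔
      ∀ ε : ℝ, 0 < ε → ∃ κ : ℝ, ∀ a b c : ℕ, IsABCTriple a b c →
        Real.log c ≤ κ * (rad a b c : ℝ) ^ (2 / 3 + ε : ℝ) :=
  stewartYu1991_iff_epsShapeBound.trans (epsShapeBound_iff_thresholdFree (by norm_num))

/-- `EpsShapeBound θ₀` (`θ₀ ≥ 0`) gives the `ε`-free shape `BakerShapeBound θ 0` (`log c ≤ κ · rad^θ` for
every abc triple) for every `θ > θ₀` (take `ε = θ − θ₀` and absorb the threshold; `(log rad)^0 = 1`).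
[cite: Waldschmidt2014, §2] -/
theorem bakerShapeBound_of_epsShapeBound {θ₀ θ : ℝ} (hθ₀ : 0 ≤ θ₀) (hlt : θ₀ < θ)
    (h : EpsShapeBound θ₀) : BakerShapeBound θ 0 := by
  obtain ⟨κ, hκ⟩ := (epsShapeBound_iff_thresholdFree hθ₀).mp h (θ - θ₀) (by linarith)
  refine ⟨κ, fun a b c ht => ?_⟩
  have h1 := hκ a b c ht
  have hθ : (θ₀ + (θ - θ₀) : ℝ) = θ := by ring
  rw [hθ] at h1
  rw [pow_zero, mul_one]
  exact h1

/-- **Stewart–Tijdeman 1986 from Stewart–Yu 1991**: the `ε`-form `log c ≤ κ(ε) rad^{2/3+ε}` (`c ≥ c₀(ε)`)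
implies `log c ≤ κ rad^{15}` for all abc triples (`ε = 15 − 2/3`, threshold absorbed).
[cite: StewartTijdeman1986, Theorem 1 (upper bound), as quoted in Waldschmidt2014 §2] -/
theorem stewartTijdeman1986_of_stewartYu1991 (h : stewartYu1991_upperBound) :
    stewartTijdeman1986_upperBound :=
  bakerShapeBound_of_epsShapeBound (θ₀ := 2 / 3) (by norm_num) (by norm_num)
    (stewartYu1991_iff_epsShapeBound.mp h)

end Literature.Barriers.ABC
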